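import Summits.Ventures.HodgeRepro.RouteChain

/-!
# Lemma R (S3ᴿ), the geometric half on the route interface: `HC_p(B_red) ⇒ W_F(B)` algebraic from the two paper
sentences typed as named hypotheses

Blind re-derivation cell `pub-hodge-repro`, seat `t3-p4` (Tier 3, sub-goal T3.4 = Lemma R, route/TIER3.md v0.1 §2).
Target tree path `lean/Summits/Ventures/HodgeRepro/Tier3LemmaR.lean`; continues night-4's `RouteChain.lean`
(the interface `RouteData`: varieties, morphisms, `H p X = H^{2p}(X, ℚ)(p)`, `pull`, `hodge`, `alg`, the Weil line
`weil p B = W_F(B)`).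

ROUTE.md §1 row S3ᴿ (Lemma R — the lead's converse of S3, UNPRINTED, routine): «Let `B = ∏_{i=1}^{2p} A_{T_i}` be a corner
product with `Σ_i 1_{T_i} ≡ p`, the corners sorted into isogeny classes `A_1, …, A_m` …; if within each class the twists
are pairwise distinct, then `W_F(B)` lies in the `ℚ`-span of the pull-backs, along algebraic morphisms `B → B_red :=
∏_j A_j`, of the codimension-`p` Hodge classes of `B_red` — these being the Pohlmann lines of the `2p`-sets
`{(j(i), s·g_i⁻¹)}`.  Hence HC in codimension `p` for `B_red` ⇒ S4 for `B`.»  Status line: «combinatorial core CHECKED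
(typer's FaceReduce); the geometric half (sum map, Artin, pull-back) is paper-level».  Night-1 put the LINEAR ALGEBRA of
the geometric half on the kernel — `Night1ReducedPullback.lean` (the `σ`-line of `W_F(B) ⊗ ℂ` is the `lineSet σ`-component
of `m^* e_{U_σ}`, coefficient exactly `1`: `wedgeComponent_lineEnum_map_pullLin_reducedWedge`) and
`Night1ArtinProjector.lean` (the component projections are polynomials in the torus action) — and names what stays on
paper: (S1) the sum map `m` is an algebraic morphism and `m^*` its pull-back; (S2) the eigen-component projector is a
`ℚ`-rational algebraic correspondence.  `proofs/t3-p4/LEMMA-R-RESIDUE.md` proves (S1) and (S2) on paper (the projector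
onto the diagonal orbit is the idempotent `e_{O_Δ}` of the étale algebra `F^{⊗ 2p}` acting by pull-backs along
endomorphisms of `B`; `W_F(B)` is a rank-one `F`-module, generated by any non-zero vector).  THIS FILE types that argument
on the route interface: the data `LemmaRData` (one corner product `B`, its reduced product `Bred`, the field `F`, the
action of `F` on `H^{2p}(B)` through the first corner's CM structure, the projector `e`, the morphism `m` and the Hodge
class `η`), the two paper sentences and the two kernel facts as named `Prop`s, and the theorem `weil_le_alg_of_HC` =
Lemma R's conclusion.

HONESTY.  Nothing geometric is constructed and no mathematical content of Lemma R is proved here beyond the logical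
composition: `weil_le_alg_of_HC` says exactly that IF the four named statements hold for `(B, Bred, F, act, e, m, η)` THEN
`HC_p(B_red)` makes `W_F(B)` algebraic.  Nothing here says anything about the status of the Hodge conjecture for CM abelian
varieties, which is NOT proved.
-/

set_option autoImplicit false

open Finset

namespace HodgeRepro.Route

/-- **The data of Lemma R for ONE corner product**: the route interface `𝓗`, the codimension `p`, the corner product
`B = ∏_i A_{T_i}`, its reduced product `Bred = ∏_j A_j` (the corners sorted into isogeny classes, ROUTE.md S3ᴿ), the CM
field `F` (Galois over `ℚ`; `H¹(A_{T_i}, ℚ)` is a free `F`-module of rank `1` for every corner, Milne 2020 §1.1), the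
action `act a` of `a ∈ F` on `H^{2p}(B, ℚ)` — the pull-back along the endomorphism `(ι_1(a), 1, …, 1)` of `B` (the CM
structure of the FIRST corner; on the Weil line `W_F(B) ⊗ ℂ = ⊕_σ ⊗_i ℓ^{(i)}_σ` it acts by `σ(a)` on the `σ`-line, i.e. as
the `F`-module structure of `W_F(B) = ∧^{2p}_F H¹(B, ℚ)`), the projector `e` onto the diagonal-orbit isotypic component
(`e_{O_Δ} ∈ F^{⊗ 2p}`, LEMMA-R-RESIDUE.md (S2)), the morphism `m : B → Bred` (the product of the sum maps
`A_j^{I_j} → A_j`) and a Hodge class `η` of `Bred` in the `ℚ`-span of the Pohlmann lines of the reduced sets.  The fields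
are DATA; the statements about them are the `Prop`s below. -/
structure LemmaRData where
  /-- the route interface -/
  𝓗 : RouteData
  /-- the codimension `p` (`2p` corners) -/
  p : ℕ
  /-- the corner product `B` -/
  B : 𝓗.Var
  /-- the reduced product `B_red` -/
  Bred : 𝓗.Var
  /-- the CM field `F` (as a type of scalars: no field axiom is used below — the rank-one statement `WeilRankOne` is
  stated in elementary form, «every non-zero `w ∈ W_F(B)` generates») -/
  F : Type
  /-- `act a = (ι_1(a), 1, …, 1)^*` on `H^{2p}(B, ℚ)` -/
  act : F → (𝓗.H p B →ₗ[ℚ] 𝓗.H p B)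
  /-- the projector onto the diagonal-orbit component, `e_{O_Δ}` -/
  e : 𝓗.H p B →ₗ[ℚ] 𝓗.H p B
  /-- the morphism `m : B → B_red` (the product of the sum maps) -/
  m : 𝓗.Hom B Bred
  /-- the Hodge class `η` of `B_red` (a `ℚ`-rational combination of the Pohlmann lines `⟨U_σ⟩` of the reduced sets) -/
  η : 𝓗.H p Bred

variable (𝓛 : LemmaRData)

/-! ## The two paper sentences (S1), (S2) and the two kernel facts, as named statements -/

/-- **(S1) — pull-backs along endomorphisms of `B` and along `m` preserve algebraic classes, and `act a` IS such a
pull-back.**  PRINTED / definitional: `m` and `(ι_1(a), 1, …, 1)` are homomorphisms of abelian varieties, hence regular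
maps; pull-back of the class of a cycle along a regular map is the class of the pulled-back cycle (André 1996 Thm 0.3(ii),
functoriality — night-4's `AlgPull`, the same clause S0 ⇐ S3 ∧ S4 uses); Milne 1999, Duke Math. J. 96, Cor 5.6 (store
paper:doi-10-1215-s0012-7094-99-09620-5 p0025:L48, SOURCES row L447 VERBATIM): «The graph of any regular map α: A → B of
abelian varieties is Lefschetz» — so these pull-backs are even Lefschetz correspondences.  Typed: the functoriality clause
of `AlgPull` together with «every `act a` is the pull-back along some endomorphism `α_a : B → B`». -/
def PullbackSentence : Prop :=
  AlgPull 𝓛.𝓗 ∧ ∀ a : 𝓛.F, ∃ α : 𝓛.𝓗.Hom 𝓛.B 𝓛.B, 𝓛.act a = 𝓛.𝓗.pull α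

/-- **(S2) — the orbit projector is a `ℚ`-rational algebraic correspondence.**  LEMMA-R-RESIDUE.md: the étale `ℚ`-algebra
`R = F^{⊗ 2p}` acts on the Künneth component `⊗_i H¹(A_{T_i}, ℚ)` through the corner-wise CM structures — every element of
`R` acts by a `ℚ`-linear combination of pull-backs along endomorphisms `(ι_1(a_1), …, ι_{2p}(a_{2p}))` of `B` — and the
projector onto the diagonal-orbit component `⊕_σ ⊗_i ℓ^{(i)}_σ = W_F(B) ⊗ ℂ` is the primitive idempotent `e_{O_Δ} ∈ R`
of the orbit of the diagonal tuples (`ℚ`-rational: `R = ∏_O F_O` over the `Aut(ℂ/ℚ)`-orbits `O` on `Hom(F, ℂ)^{2p}`).  Typed: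
`e` is a finite `ℚ`-linear combination of pull-backs along endomorphisms of `B`, and `e` lands in `W_F(B)`. -/
def ProjectorSentence : Prop :=
  (∃ (n : ℕ) (q : Fin n → ℚ) (α : Fin n → 𝓛.𝓗.Hom 𝓛.B 𝓛.B), 𝓛.e = ∑ k, q k • 𝓛.𝓗.pull (α k)) ∧
  ∀ x : 𝓛.𝓗.H 𝓛.p 𝓛.B, 𝓛.e x ∈ 𝓛.𝓗.weil 𝓛.p 𝓛.B

/-- **Kernel fact 1 — the non-vanishing of the diagonal component of `m^* η`.**  CELL: night-1
`Night1ReducedPullback.lean` `wedgeComponent_lineEnum_map_pullLin_reducedWedge` (the `σ`-line of `W_F(B)` is the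
`lineSet σ`-component of `m^* e_{U_σ}` with coefficient exactly `1`, for injective `(cls, tw)`), so for `η = Σ_σ c_σ e_{U_σ}`
with some `c_σ ≠ 0` (a non-zero element of the `ℚ`-span of the Pohlmann lines of the reduced sets, Hodge by typer's
`FaceReduce.lean` `isHodgeSetProd_reducedSet`) the diagonal projection `e(m^* η) = Σ_σ c_σ (± w_σ)` is non-zero — distinct
`σ` give distinct eigen-lines.  Typed: `η` is a Hodge class of `B_red` and `e (m^* η) ≠ 0`. -/
def NonvanishingComponent : Prop :=
  𝓛.η ∈ 𝓛.𝓗.hodge 𝓛.p 𝓛.Bred ∧ 𝓛.e (𝓛.𝓗.pull 𝓛.m 𝓛.η) ≠ 0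

/-- **Kernel fact 2 — `W_F(B)` is a rank-one `F`-module under `act`.**  `W_F(B) = ∧^{2p}_F H¹(B, ℚ)` with `H¹(B, ℚ) =
⊕_i H¹(A_{T_i}, ℚ)` free of rank `2p` over `F` (each corner free of rank `1`, Milne 2020 §1.1: «`H¹(A, ℚ)` is free of
rank 1 as an `E`-module»; Deligne LNM 900 §4, the Weil classes `∧^d_E H¹(A, ℚ) ⊂ H^d(A, ℚ)`, SOURCES rows L18 / L244),
so `W_F(B)` is free of rank `1` over `F`, the `F`-action being `act` (on `⊗_i ℓ^{(i)}_σ` the first corner's `ι_1(a)^*`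
acts by `σ(a)`).  Typed in elementary form: `W_F(B)` is `act`-stable and every non-zero `w ∈ W_F(B)` generates it —
`∀ x ∈ W_F(B), ∃ a, x = act a w`. -/
def WeilRankOne : Prop :=
  (∀ (a : 𝓛.F) (w : 𝓛.𝓗.H 𝓛.p 𝓛.B), w ∈ 𝓛.𝓗.weil 𝓛.p 𝓛.B → 𝓛.act a w ∈ 𝓛.𝓗.weil 𝓛.p 𝓛.B) ∧
  ∀ w ∈ 𝓛.𝓗.weil 𝓛.p 𝓛.B, w ≠ 0 → ∀ x ∈ 𝓛.𝓗.weil 𝓛.p 𝓛.B, ∃ a : 𝓛.F, x = 𝓛.act a w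

/-! ## Lemma R's conclusion -/

/-- A `ℚ`-linear combination of pull-backs along endomorphisms of `B` carries algebraic classes of `B` to algebraic
classes (the functoriality clause of `AlgPull`, summed). -/
theorem sum_pull_mem_alg (hpull : AlgPull 𝓛.𝓗) {n : ℕ} (q : Fin n → ℚ) (α : Fin n → 𝓛.𝓗.Hom 𝓛.B 𝓛.B)
    {x : 𝓛.𝓗.H 𝓛.p 𝓛.B} (hx : x ∈ 𝓛.𝓗.alg 𝓛.p 𝓛.B) :
    (∑ k, q k • 𝓛.𝓗.pull (α k)) x ∈ 𝓛.𝓗.alg 𝓛.p 𝓛.B := by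
  rw [LinearMap.sum_apply]
  refine Submodule.sum_mem _ fun k _ => ?_
  rw [LinearMap.smul_apply]
  exact Submodule.smul_mem _ _ (hpull.1 (α k) (Submodule.mem_map_of_mem hx))

/-- **The algebraic generator**: `w₀ := e(m^* η)` is a non-zero algebraic class in `W_F(B)` once `HC_p(B_red)` holds —
`η` algebraic by `HC_p(B_red)`, `m^* η` algebraic (S1), `e(m^* η)` algebraic (S2: a `ℚ`-combination of pull-backs along
endomorphisms), in `W_F(B)` (S2) and non-zero (kernel fact 1). -/
theorem generator_mem_alg (hS1 : PullbackSentence 𝓛) (hS2 : ProjectorSentence 𝓛)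
    (hHC : 𝓛.𝓗.hodge 𝓛.p 𝓛.Bred ≤ 𝓛.𝓗.alg 𝓛.p 𝓛.Bred) (hη : 𝓛.η ∈ 𝓛.𝓗.hodge 𝓛.p 𝓛.Bred) :
    𝓛.e (𝓛.𝓗.pull 𝓛.m 𝓛.η) ∈ 𝓛.𝓗.alg 𝓛.p 𝓛.B := by
  obtain ⟨n, q, α, he⟩ := hS2.1
  have h1 : 𝓛.𝓗.pull 𝓛.m 𝓛.η ∈ 𝓛.𝓗.alg 𝓛.p 𝓛.B :=
    hS1.1.1 𝓛.m (Submodule.mem_map_of_mem (hHC hη))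
  rw [he]
  exact sum_pull_mem_alg 𝓛 hS1.1 q α h1

/-- **Lemma R, the conclusion** (ROUTE.md §1 row S3ᴿ «Hence HC in codimension `p` for `B_red` ⇒ S4 for `B`»): if every
Hodge class of codimension `p` on `B_red` is algebraic, then the Weil line `W_F(B)` consists of algebraic classes.  Proof:
`w₀ = e(m^* η)` is a non-zero algebraic element of `W_F(B)` (`generator_mem_alg`); `W_F(B)` is a rank-one `F`-module, so
every `x ∈ W_F(B)` is `act a w₀` for some `a ∈ F` (kernel fact 2), and `act a` is a pull-back along an endomorphism (S1),
which preserves algebraic classes. -/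
theorem weil_le_alg_of_HC (hS1 : PullbackSentence 𝓛) (hS2 : ProjectorSentence 𝓛)
    (hnv : NonvanishingComponent 𝓛) (hrk : WeilRankOne 𝓛)
    (hHC : 𝓛.𝓗.hodge 𝓛.p 𝓛.Bred ≤ 𝓛.𝓗.alg 𝓛.p 𝓛.Bred) :
    𝓛.𝓗.weil 𝓛.p 𝓛.B ≤ 𝓛.𝓗.alg 𝓛.p 𝓛.B := by
  intro x hx
  have hw₀ : 𝓛.e (𝓛.𝓗.pull 𝓛.m 𝓛.η) ∈ 𝓛.𝓗.alg 𝓛.p 𝓛.B :=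
    generator_mem_alg 𝓛 hS1 hS2 hHC hnv.1
  obtain ⟨a, ha⟩ := hrk.2 _ (hS2.2 _) hnv.2 x hx
  obtain ⟨α, hα⟩ := hS1.2 a
  rw [ha, hα]
  exact hS1.1.1 α (Submodule.mem_map_of_mem hw₀)

/-- The same, packaged: the four named statements as one hypothesis bundle. -/
structure LemmaRStatements : Prop where
  /-- (S1) -/
  s1 : PullbackSentence 𝓛
  /-- (S2) -/
  s2 : ProjectorSentence 𝓛
  /-- kernel fact 1 -/
  nonvanishing : NonvanishingComponent 𝓛
  /-- kernel fact 2 -/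
  rankOne : WeilRankOne 𝓛

/-- Lemma R from the bundle. -/
theorem weil_le_alg_of_HC' (h : LemmaRStatements 𝓛)
    (hHC : 𝓛.𝓗.hodge 𝓛.p 𝓛.Bred ≤ 𝓛.𝓗.alg 𝓛.p 𝓛.Bred) :
    𝓛.𝓗.weil 𝓛.p 𝓛.B ≤ 𝓛.𝓗.alg 𝓛.p 𝓛.B :=
  weil_le_alg_of_HC 𝓛 h.s1 h.s2 h.nonvanishing h.rankOne hHC

end HodgeRepro.Route
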